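import Mathlib
import HarnessLib
import Literature.Analysis.FluidPDE.Tao2016AveragedNS.BoundedEternalSolutions
import Summits.NavierStokesRegularity.NavierStokesRegularity.Theorems.WakeRatchetMinimalViscousBlowupEveryShellFires
import Summits.NavierStokesRegularity.NavierStokesRegularity.Theorems.WakeRatchetMinimalViscousBlowupThresholdContinuity

/-!
# Route `WakeRatchet`, crux `MinimalViscousBlowup` (stmt-NavierStokesRegularity-22743) — LINE g11-1 «threshold ray» (ns-idea-1 g11), reduction (C1)–(C2) of
# STUB-PLAN-typeOneClock.md for stub S5 `stub_typeOneClock`: THE CLOCK CLAUSE FROM THE FRONT CLOCK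

The FRONT CLOCK hypothesis (FC), first-firing-time free: «a shell `m ≥ 0` that has not fired (level `λ^m‖X_m‖² < c₀ν²`, `c₀ = 1/(32768λ^{16})`, the S4
level) on `[0,t]` leaves at most `Kλ^{−2m}` of life: `T − t ≤ K/λ^{2m}`».
* `clock_of_frontClock` — **S5's CLOCK clause from (FC)**: under the trajectory clauses of S5 (regular on every `[0,T']`, one-shell datum, critical
  envelope `λⁿ‖X_n‖² ≤ C`) and (FC), `Λⁿ(T−t)‖X_n(t)‖ ≤ K(√C + ν√c₀)` for all `n` and `0 ≤ t < T` (`Λ = bigLam ε₀ = λ^{5/2}`): at time `t` some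
  shell `m₁` has not fired (the (4.5) bound on `[0,(t+T)/2]`); shells `n ≤ m₁` are envelope-bounded and `λ^{2n−2m₁} ≤ 1`; shells `n = m₁ + j` obey
  the geometric pre-arrival tails of `valve_induction`, and `λ^{2j}√(c_j) ≤ √c₀`.
MODEL lattice ODEs only; nothing here concerns the Navier–Stokes equations (no NS regularity statement is proved).
`--supports stmt-NavierStokesRegularity-22743 --as helper`.
[cite: Tao2016AveragedNS, §4 Lemma 4.1 (4.5), §5 (the blow-up clock of the cascade); BarbatoMorandinRomito2011, §3.1]
-/

noncomputable section

-- the summit and its single sub-problem share the name (CONVENTIONS §1)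
set_option linter.dupNamespace false

open Set Filter Topology

namespace Summit.NavierStokesRegularity.NavierStokesRegularity.Theorems.MinimalViscousBlowup.ThresholdRay

open Literature.Analysis.FluidPDE Literature.Analysis.FluidPDE.TaoCascade

/-- `Λⁿ‖v‖ ≤ λ^{2n} B` whenever `λⁿ‖v‖² ≤ B²` (`Λ = λ^{5/2}`, squares compared). [folklore] -/
theorem bigLam_pow_mul_norm_le {ε₀ B : ℝ} (hε : 0 < ε₀) (hB : 0 ≤ B) {X : Fin 4 → ℤ → ℝ → ℝ} {t : ℝ} (n : ℕ)
    (h : (1 + ε₀) ^ n * ‖shellVec X n t‖ ^ 2 ≤ B ^ 2) :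
    bigLam ε₀ ^ n * ‖shellVec X n t‖ ≤ (1 + ε₀) ^ (2 * n) * B := by
  have hl0 : (0 : ℝ) < 1 + ε₀ := by linarith
  have hΛ : 0 < bigLam ε₀ := bigLam_pos (by linarith)
  have hsq : (bigLam ε₀ ^ n * ‖shellVec X n t‖) ^ 2 ≤ ((1 + ε₀) ^ (2 * n) * B) ^ 2 := by
    rw [mul_pow, mul_pow, bigLam_pow_sq hε.le n, show (5 : ℕ) * n = 4 * n + n by ring, pow_add, ← pow_mul,
      show 2 * n * 2 = 4 * n by ring, mul_assoc]
    exact mul_le_mul_of_nonneg_left h (pow_nonneg hl0.le _)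
  exact (pow_le_pow_iff_left₀ (by positivity) (by positivity) two_ne_zero).1 hsq

/-- **S5 CLOCK clause from the front clock (FC).**  `λ = 1+ε₀ > 1`, `ν > 0`, a cancelling table with `|α_{··(0,0,1)}| ≤ 1`, a regular trajectory of the
`ν`-viscous lattice on `[0,T)` from a one-shell datum with no shells below `0`, a critical envelope `λⁿ‖X_n(t)‖² ≤ C`, and the FRONT CLOCK at the S4
level `c₀ = 1/(32768λ^{16})`: a shell `m` not fired on `[0,t]` forces `T − t ≤ K/λ^{2m}`.  Then `Λⁿ(T−t)‖X_n(t)‖ ≤ K(√C + ν√c₀)` for all `n`, `0 ≤ t < T`.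
[cite: Tao2016AveragedNS, §4 Lemma 4.1 (4.5); BarbatoMorandinRomito2011, §3.1] -/
theorem clock_of_frontClock {ε₀ ν T C K : ℝ} (hε : 0 < ε₀) (hν : 0 < ν) (hT : 0 < T)
    {α : Fin 4 → Fin 4 → Fin 4 → ℤ × ℤ × ℤ → ℝ} (hcan : IsCancellingCoeff α) (hα1 : ∀ i₁ i₂ i₃, |α i₁ i₂ i₃ (0, 0, 1)| ≤ 1)
    {X₀ : Fin 4 → ℝ} {X : Fin 4 → ℤ → ℝ → ℝ}
    (hcd : ∀ i n, ContDiffOn ℝ 1 (X i n) (Ico 0 T))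
    (hinit : ∀ i n, X i n 0 = if n = 0 then X₀ i else 0)
    (hlow : ∀ i n t, n < 0 → X i n t = 0)
    (hmot : ∀ i n t, 0 ≤ t → t < T → derivWithin (X i n) (Ici 0) t =
      quadTerm ε₀ α X i n t - ν * (1 + ε₀) ^ ((2 : ℝ) * n) * X i n t)
    (hreg : ∀ T' : ℝ, 0 < T' → T' < T → ∃ M : ℝ, ∀ t : ℝ, 0 ≤ t → t ≤ T' →
      ∀ (i : Fin 4) (n : ℤ), (1 + (1 + ε₀) ^ ((10 : ℝ) * n)) * |X i n t| ≤ M)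
    (henv : ∀ (n : ℤ) (t : ℝ), 0 ≤ t → t < T → (1 + ε₀) ^ n * ‖shellVec X n t‖ ^ 2 ≤ C)
    (hFC : ∀ (m : ℕ) (t : ℝ), 0 ≤ t → t < T →
      (∀ s, 0 ≤ s → s ≤ t → (1 + ε₀) ^ m * ‖shellVec X m s‖ ^ 2 < 1 / (32768 * (1 + ε₀) ^ 16) * ν ^ 2) →
      T - t ≤ K / (1 + ε₀) ^ (2 * m)) :
    ∀ (n : ℤ) (t : ℝ), 0 ≤ t → t < T →
      bigLam ε₀ ^ n * (T - t) * ‖shellVec X n t‖ ≤ K * (Real.sqrt C + ν * Real.sqrt (1 / (32768 * (1 + ε₀) ^ 16))) := by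
  intro n t ht0 htT
  have hl0 : (0 : ℝ) < 1 + ε₀ := by linarith
  have hl1 : (1 : ℝ) ≤ 1 + ε₀ := by linarith
  set c₀ : ℝ := 1 / (32768 * (1 + ε₀) ^ 16) with hc₀
  have hc₀0 : 0 < c₀ := by rw [hc₀]; positivity
  have hC0 : 0 ≤ C := le_trans (by positivity) (henv 0 0 le_rfl hT)
  -- Step 1: some shell `m₁` has not fired on `[0,t]`
  set T' : ℝ := (t + T) / 2 with hT'
  have hT'0 : 0 < T' := by rw [hT']; linarith
  have htT' : t ≤ T' := by rw [hT']; linarith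
  have hT'T : T' < T := by rw [hT']; linarith
  obtain ⟨M₀, hM₀⟩ := hreg T' hT'0 hT'T
  set M : ℝ := max M₀ 0 with hMdef
  have hM0 : 0 ≤ M := le_max_right _ _
  have hdecay : ∀ s, 0 ≤ s → s ≤ t → ∀ m : ℕ,
      (1 + ε₀) ^ (19 * m) * ((1 + ε₀) ^ m * ‖shellVec X m s‖ ^ 2) ≤ 4 * M ^ 2 := by
    intro s hs0 hst m
    have hP : (0 : ℝ) < (1 + ε₀) ^ (10 * m) := pow_pos hl0 _
    have hX : ∀ i : Fin 4, |X i m s| ≤ M / (1 + ε₀) ^ (10 * m) := by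
      intro i
      have h := (hM₀ s hs0 (hst.trans htT') i m).trans (le_max_left M₀ 0)
      have hw : (1 + ε₀) ^ ((10 : ℝ) * ((m : ℕ) : ℤ)) = (1 + ε₀) ^ (10 * m) := by
        rw [show ((10 : ℝ) * (((m : ℕ) : ℤ) : ℝ)) = ((10 * m : ℕ) : ℝ) by push_cast; ring, Real.rpow_natCast]
      rw [hw] at h
      rw [le_div_iff₀ hP]
      nlinarith [abs_nonneg (X i m s)]
    have hn := norm_shellVec_le_two_mul (by positivity) hX
    have hsq : ‖shellVec X m s‖ ^ 2 ≤ (2 * (M / (1 + ε₀) ^ (10 * m))) ^ 2 := pow_le_pow_left₀ (norm_nonneg _) hn 2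
    calc (1 + ε₀) ^ (19 * m) * ((1 + ε₀) ^ m * ‖shellVec X m s‖ ^ 2)
        ≤ (1 + ε₀) ^ (19 * m) * ((1 + ε₀) ^ m * (2 * (M / (1 + ε₀) ^ (10 * m))) ^ 2) := by gcongr
      _ = 4 * M ^ 2 := by
          have hne : (1 + ε₀) ^ (10 * m) ≠ 0 := hP.ne'
          field_simp
          ring
  have h19 : (1 : ℝ) < (1 + ε₀) ^ 19 := one_lt_pow₀ (by linarith) (by norm_num)
  obtain ⟨m₁, hm₁⟩ := pow_unbounded_of_one_lt ((4 * M ^ 2 + 1) / (c₀ * ν ^ 2)) h19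
  have hnf : ∀ s, 0 ≤ s → s ≤ t → (1 + ε₀) ^ m₁ * ‖shellVec X m₁ s‖ ^ 2 < c₀ * ν ^ 2 := by
    intro s hs0 hst
    have h1 := hdecay s hs0 hst m₁
    rw [← pow_mul] at hm₁
    rw [div_lt_iff₀ (by positivity)] at hm₁
    by_contra hcon
    have hge : c₀ * ν ^ 2 ≤ (1 + ε₀) ^ m₁ * ‖shellVec X (m₁ : ℤ) s‖ ^ 2 := not_lt.1 hcon
    have := mul_le_mul_of_nonneg_left hge (pow_nonneg hl0.le (19 * m₁))
    nlinarith
  -- Step 2: the front clock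
  have hKt : T - t ≤ K / (1 + ε₀) ^ (2 * m₁) := hFC m₁ t ht0 htT hnf
  have hP2 : (0 : ℝ) < (1 + ε₀) ^ (2 * m₁) := pow_pos hl0 _
  have hK0 : 0 < K := by
    have h1 : 0 < K / (1 + ε₀) ^ (2 * m₁) := lt_of_lt_of_le (by linarith) hKt
    have := (div_pos_iff.1 h1)
    rcases this with ⟨hK, _⟩ | ⟨_, hneg⟩
    · exact hK
    · exact absurd hneg (not_lt.2 hP2.le)
  -- Step 3: non-firing persists a little beyond `t`; pre-arrival tails at `t`
  have hcont : ContinuousWithinAt (fun s => (1 + ε₀) ^ m₁ * ‖shellVec X (m₁ : ℤ) s‖ ^ 2) (Ico 0 T) t := by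
    have heq : (fun s => (1 + ε₀) ^ m₁ * ‖shellVec X (m₁ : ℤ) s‖ ^ 2) =
        fun s => (1 + ε₀) ^ m₁ * ∑ i : Fin 4, X i m₁ s ^ 2 := by
      funext s; rw [norm_shellVec_sq]
    rw [heq]
    refine continuousWithinAt_const.mul ?_
    refine tendsto_finsetSum _ fun i _ => ?_
    exact (((hcd i m₁).continuousOn t ⟨ht0, htT⟩)).pow 2
  have hev : ∀ᶠ s in 𝓝[Ico 0 T] t, (1 + ε₀) ^ m₁ * ‖shellVec X (m₁ : ℤ) s‖ ^ 2 < c₀ * ν ^ 2 :=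
    Filter.Tendsto.eventually_lt hcont tendsto_const_nhds (hnf t ht0 le_rfl)
  obtain ⟨δ, hδ, hball⟩ := Metric.mem_nhdsWithin_iff.1 hev
  set Tw : ℝ := min (t + δ) T with hTw
  have htTw : t < Tw := lt_min (by linarith) htT
  have hTwT : Tw ≤ T := min_le_right _ _
  have hTw0 : 0 < Tw := lt_of_le_of_lt ht0 htTw
  have hwin : ∀ s, 0 ≤ s → s < Tw → (1 + ε₀) ^ m₁ * ‖shellVec X (m₁ : ℤ) s‖ ^ 2 ≤ c₀ * ν ^ 2 := by
    intro s hs0 hsw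
    rcases le_or_gt s t with hst | hst
    · exact (hnf s hs0 hst).le
    · have hmem : s ∈ Metric.ball t δ ∩ Ico 0 T := by
        refine ⟨?_, hs0, lt_of_lt_of_le hsw hTwT⟩
        rw [Metric.mem_ball, Real.dist_eq, abs_of_pos (by linarith)]
        linarith [min_le_left (t + δ) T]
      exact le_of_lt (hball hmem)
  have htails := valve_induction (T := Tw) hε hν hTw0 hc₀0 le_rfl hcan hα1 (X₀ := X₀)
    (fun i k => (hcd i k).mono (Ico_subset_Ico_right hTwT)) hinit
    (fun i k s hs0 hsw => hmot i k s hs0 (lt_of_lt_of_le hsw hTwT))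
    (fun T'' h0 hlt => hreg T'' h0 (lt_of_lt_of_le hlt hTwT)) m₁ hwin
  -- Step 4: the shells
  have hRHS : 0 ≤ K * (Real.sqrt C + ν * Real.sqrt c₀) := by positivity
  rcases lt_or_ge n 0 with hn | hn
  · have h0 : shellVec X n t = 0 := by
      ext j
      simp [shellVec_apply, hlow j n t hn]
    rw [h0, norm_zero, mul_zero]
    exact hRHS
  obtain ⟨n', rfl⟩ := Int.eq_ofNat_of_zero_le hn
  rw [zpow_natCast]
  have hTt : 0 ≤ T - t := by linarith
  rcases le_or_gt n' m₁ with hle | hgt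
  · -- below the non-fired shell: the envelope
    have he := henv n' t ht0 htT
    rw [zpow_natCast, ← Real.sq_sqrt hC0] at he
    have hb := bigLam_pow_mul_norm_le hε (Real.sqrt_nonneg C) n' he
    have hpow : (1 + ε₀) ^ (2 * n') ≤ (1 + ε₀) ^ (2 * m₁) := pow_le_pow_right₀ hl1 (by omega)
    calc bigLam ε₀ ^ n' * (T - t) * ‖shellVec X (n' : ℤ) t‖
        = (bigLam ε₀ ^ n' * ‖shellVec X (n' : ℤ) t‖) * (T - t) := by ring
      _ ≤ ((1 + ε₀) ^ (2 * n') * Real.sqrt C) * (K / (1 + ε₀) ^ (2 * m₁)) :=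
          mul_le_mul hb hKt hTt (by positivity)
      _ ≤ ((1 + ε₀) ^ (2 * m₁) * Real.sqrt C) * (K / (1 + ε₀) ^ (2 * m₁)) := by gcongr
      _ = K * Real.sqrt C := by field_simp
      _ ≤ K * (Real.sqrt C + ν * Real.sqrt c₀) := by
          nlinarith [mul_nonneg (mul_nonneg hK0.le hν.le) (Real.sqrt_nonneg c₀)]
  · -- above: the pre-arrival tails, `n' = m₁ + j`
    obtain ⟨j, rfl⟩ := Nat.exists_eq_add_of_lt hgt
    have hj : m₁ + j + 1 = m₁ + (j + 1) := by ring
    have ht1 := htails (j + 1) t ht0 htTw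
    rw [← hj] at ht1
    set cj : ℝ := c₀ / (2 * (1 + ε₀) ^ 19) ^ (j + 1) with hcj
    have hcj0 : 0 ≤ cj := by rw [hcj]; positivity
    have hB : (1 + ε₀) ^ (m₁ + j + 1) * ‖shellVec X ((m₁ + j + 1 : ℕ) : ℤ) t‖ ^ 2 ≤ (ν * Real.sqrt cj) ^ 2 := by
      rw [mul_pow, Real.sq_sqrt hcj0]; linarith
    have hb := bigLam_pow_mul_norm_le hε (by positivity) (m₁ + j + 1) hB
    -- `λ^{2(j+1)} √c_{j+1} ≤ √c₀`
    have hgeom : (1 + ε₀) ^ (2 * (j + 1)) * Real.sqrt cj ≤ Real.sqrt c₀ := by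
      have hsq : ((1 + ε₀) ^ (2 * (j + 1)) * Real.sqrt cj) ^ 2 ≤ (Real.sqrt c₀) ^ 2 := by
        rw [mul_pow, Real.sq_sqrt hcj0, Real.sq_sqrt hc₀0.le, hcj, ← pow_mul, show 2 * (j + 1) * 2 = 4 * (j + 1) by ring]
        rw [pow_mul, mul_div_assoc', div_le_iff₀ (by positivity), mul_comm c₀]
        refine mul_le_mul_of_nonneg_right (pow_le_pow_left₀ (by positivity) ?_ _) hc₀0.le
        linarith [one_le_pow₀ hl1 (n := 19), pow_le_pow_right₀ hl1 (show 4 ≤ 19 by norm_num)]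
      exact (pow_le_pow_iff_left₀ (by positivity) (Real.sqrt_nonneg _) two_ne_zero).1 hsq
    have hsplit : (1 + ε₀) ^ (2 * (m₁ + j + 1)) = (1 + ε₀) ^ (2 * m₁) * (1 + ε₀) ^ (2 * (j + 1)) := by
      rw [← pow_add]; ring_nf
    calc bigLam ε₀ ^ (m₁ + j + 1) * (T - t) * ‖shellVec X ((m₁ + j + 1 : ℕ) : ℤ) t‖
        = (bigLam ε₀ ^ (m₁ + j + 1) * ‖shellVec X ((m₁ + j + 1 : ℕ) : ℤ) t‖) * (T - t) := by ring
      _ ≤ ((1 + ε₀) ^ (2 * (m₁ + j + 1)) * (ν * Real.sqrt cj)) * (K / (1 + ε₀) ^ (2 * m₁)) :=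
          mul_le_mul hb hKt hTt (by positivity)
      _ = K * ν * ((1 + ε₀) ^ (2 * (j + 1)) * Real.sqrt cj) := by rw [hsplit]; field_simp
      _ ≤ K * ν * Real.sqrt c₀ := mul_le_mul_of_nonneg_left hgeom (by positivity)
      _ ≤ K * (Real.sqrt C + ν * Real.sqrt c₀) := by
          nlinarith [mul_nonneg hK0.le (Real.sqrt_nonneg C)]

end Summit.NavierStokesRegularity.NavierStokesRegularity.Theorems.MinimalViscousBlowup.ThresholdRay

end
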